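import Literature.MathematicalPhysics.QuantumFieldTheory.Balaban1983to89.T3Thresholds
import HarnessLib

/-!
# Line «sandwich_discharge» on crux `HistoryTailL` (stmt-QuantumFields-19936), stub `stub_sandwichSweepGapCapped` (S′), B6 door item (iii) —
# «THE THRESHOLD RATIO LETTER»: `θ(K) ≤ 2^{p₀}·L^{−j∕2}·θ(K − j)` whenever `2j ≤ K` (`0 < γ ≤ 1`, `L ≥ 1`, `b₀, p₀ ≥ 0`) — the finest
# threshold against the threshold `j` levels up, with NO extra smallness of `γ`

Cell `ym3-torus` (YM ladder rung R3 = continuum SU(2) Yang–Mills on the three-torus — a RUNG, NOT the Clay problem: not d = 4, not infinite volume,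
not a mass gap); WIDTH helper seat `ym3-torus-px6` gen 8; `--supports stmt-QuantumFields-19936` (helper).  THEOREMS ONLY (0 `def`, default heartbeats).

WHY (px8 g6 ARCH-S′ §1 (1a) «`θ_K ≤ θ·L^{−j∕2}·2^{p₀}` for γ₁ small»; px8 g7 ARCH-S′ v2 «B6 DOOR» §4 OPEN (iii) «`θBal(K) ≤ 2^{p₀}L^{−j∕2}θBal(K−j)` ratio
letter»).  Bałaban's thresholds are `θ(i) = g_i·p(g_i)`, `g_i = √(γL^{−i})`, `p(g) = b₀(1 + log g⁻¹)^{p₀}` (lit ✓`T3UnitScaleTilt.θBal`, ✓`B10.pFun`).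
Going `j` levels towards the finest lattice divides the coupling by `L^{j∕2}` but GROWS the logarithmic factor; the tree so far has the lower bound
`θ(i) ≤ (√L)^k·θ(i+k)` (✓`PoincareLipschitzLPProfileSum.θBal_le_sqrt_pow_mul_θBal_add`), one-step rows, and the crude antitone row
✓`T3Thresholds.θBal_le_of_le` (`√γ ≤ e^{1−p₀}`, no `L^{−j∕2}` gain).  THIS FILE proves the sharp-up-to-`2^{p₀}` UPPER bound the B6 knit uses:
* §1 `coupling_eq_sqrt_inv_pow_mul` (`g_K = (√L⁻¹)^j·g_{K−j}`), `coupling_le_sqrt_inv_pow` (`g_{K−j} ≤ (√L⁻¹)^j` when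
  `j ≤ K − j`, `γ ≤ 1` — the coarse coupling is itself below the geometric factor), `log_inv_coupling_le` (`log g_K⁻¹ ≤ 2·log g_{K−j}⁻¹`);
* §2 `pFun_le_two_rpow_mul_pFun` (`1 + log g'⁻¹ ≤ 2(1 + log g⁻¹)` ⇒ `p(g') ≤ 2^{p₀}·p(g)`);
* §3 ★★`θBal_le_two_rpow_mul_sqrt_inv_pow_mul` (`2j ≤ K` ⇒ `θ(K) ≤ 2^{p₀}·(√L⁻¹)^j·θ(K−j)`) and the squared form ★`θBal_sq_le` (`θ(K)² ≤ 4^{p₀}·(L^j)⁻¹·θ(K−j)²`).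
HONEST SCOPE: real-variable bookkeeping on the printed threshold function; NOTHING here proves the capped stub, `HistoryTailL`, or any summit statement;
YM₃ on T³ is rung R3, not Clay. [cite: Balaban1985UV3, (3) p.256 and (7) p.257]
-/

noncomputable section

namespace Summit.QuantumFields.YangMills.Theorems.CovariantDischargeThresholdRatio

open Literature.MathematicalPhysics.QuantumFieldTheory.Balaban1983to89
open Literature.MathematicalPhysics.QuantumFieldTheory.Balaban1983to89.T3UnitScaleTilt (θBal)
open Literature.MathematicalPhysics.QuantumFieldTheory.Balaban1983to89.T3Thresholds (θBal_eq coupling_le_one)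
open Literature.MathematicalPhysics.QuantumFieldTheory.Balaban1983to89.T3ThresholdSmallness (sqrt_coupling_pos_le)

variable {L : ℕ} {γ b₀ p₀ : ℝ}

/-! ## §1 Coupling algebra across `j` levels -/

/-- **`g_K = (√L⁻¹)^j · g_{K−j}`** for `j ≤ K`. [cite: Balaban1985UV3, (3) p.256] -/
theorem coupling_eq_sqrt_inv_pow_mul (L : ℕ) (γ : ℝ) {K j : ℕ} (hjK : j ≤ K) :
    Real.sqrt (γ * ((L : ℝ)⁻¹) ^ K) = Real.sqrt ((L : ℝ)⁻¹) ^ j * Real.sqrt (γ * ((L : ℝ)⁻¹) ^ (K - j)) := by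
  have hLinv : 0 ≤ ((L : ℝ)⁻¹) := inv_nonneg.mpr (Nat.cast_nonneg L)
  have hsplit : γ * ((L : ℝ)⁻¹) ^ K = ((L : ℝ)⁻¹) ^ j * (γ * ((L : ℝ)⁻¹) ^ (K - j)) := by
    rw [show K = j + (K - j) from (Nat.add_sub_cancel' hjK).symm, pow_add, Nat.add_sub_cancel_left]
    ring
  -- `√(a^j) = (√a)^j` (= lit `Literature.NumberTheory.Automorphic.real_sqrt_pow`, inlined rather than importing an automorphic-forms module)
  have hsp : Real.sqrt (((L : ℝ)⁻¹) ^ j) = Real.sqrt ((L : ℝ)⁻¹) ^ j := by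
    rw [show ((L : ℝ)⁻¹) ^ j = (Real.sqrt ((L : ℝ)⁻¹) ^ j) ^ 2 by rw [← pow_mul, mul_comm, pow_mul, Real.sq_sqrt hLinv],
      Real.sqrt_sq (pow_nonneg (Real.sqrt_nonneg _) j)]
  rw [hsplit, Real.sqrt_mul (pow_nonneg hLinv j), hsp]

/-- **The coarse coupling is below the geometric factor**: `g_{K−j} ≤ (√L⁻¹)^j` when `j ≤ K − j`, `0 ≤ γ ≤ 1`, `L ≥ 1`
(`g_{K−j}² = γL^{−(K−j)} ≤ L^{−j}`). [cite: Balaban1985UV3, (5) p.256] -/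
theorem coupling_le_sqrt_inv_pow (hL : 1 ≤ L) (hγ1 : γ ≤ 1) {K j : ℕ} (hj : j ≤ K - j) :
    Real.sqrt (γ * ((L : ℝ)⁻¹) ^ (K - j)) ≤ Real.sqrt ((L : ℝ)⁻¹) ^ j := by
  have hL' : (1 : ℝ) ≤ L := by exact_mod_cast hL
  have hLinv : 0 ≤ ((L : ℝ)⁻¹) := inv_nonneg.mpr (Nat.cast_nonneg L)
  have hLinv1 : ((L : ℝ)⁻¹) ≤ 1 := inv_le_one_of_one_le₀ hL'
  have hsp : Real.sqrt (((L : ℝ)⁻¹) ^ j) = Real.sqrt ((L : ℝ)⁻¹) ^ j := by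
    rw [show ((L : ℝ)⁻¹) ^ j = (Real.sqrt ((L : ℝ)⁻¹) ^ j) ^ 2 by rw [← pow_mul, mul_comm, pow_mul, Real.sq_sqrt hLinv],
      Real.sqrt_sq (pow_nonneg (Real.sqrt_nonneg _) j)]
  rw [← hsp]
  refine Real.sqrt_le_sqrt ?_
  calc γ * ((L : ℝ)⁻¹) ^ (K - j) ≤ 1 * ((L : ℝ)⁻¹) ^ (K - j) :=
        mul_le_mul_of_nonneg_right hγ1 (pow_nonneg hLinv _)
    _ = ((L : ℝ)⁻¹) ^ (K - j) := one_mul _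
    _ ≤ ((L : ℝ)⁻¹) ^ j := pow_le_pow_of_le_one hLinv hLinv1 hj

/-- **`log g_K⁻¹ ≤ 2·log g_{K−j}⁻¹`** when `j ≤ K − j` (`0 < γ ≤ 1`, `L ≥ 1`): `g_K⁻¹ = (√L)^j g_{K−j}⁻¹ ≤ g_{K−j}⁻²`.
[cite: Balaban1985UV3, (3) p.256 and (7) p.257] -/
theorem log_inv_coupling_le (hL : 1 ≤ L) (hγ : 0 < γ) (hγ1 : γ ≤ 1) {K j : ℕ} (hj : j ≤ K - j) :
    Real.log (Real.sqrt (γ * ((L : ℝ)⁻¹) ^ K))⁻¹ ≤ 2 * Real.log (Real.sqrt (γ * ((L : ℝ)⁻¹) ^ (K - j)))⁻¹ := by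
  set g' := Real.sqrt (γ * ((L : ℝ)⁻¹) ^ (K - j)) with hg'
  set s := Real.sqrt ((L : ℝ)⁻¹) ^ j with hs
  have hg'pos : 0 < g' := (sqrt_coupling_pos_le hL hγ (K - j)).1
  have hgK : Real.sqrt (γ * ((L : ℝ)⁻¹) ^ K) = s * g' := coupling_eq_sqrt_inv_pow_mul L γ (hj.trans (Nat.sub_le K j))
  have hgKpos : 0 < Real.sqrt (γ * ((L : ℝ)⁻¹) ^ K) := (sqrt_coupling_pos_le hL hγ K).1
  have hle : g' ≤ s := coupling_le_sqrt_inv_pow hL hγ1 hj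
  -- `(s·g')⁻¹ = s⁻¹·g'⁻¹ ≤ g'⁻¹·g'⁻¹`
  have hinv : (Real.sqrt (γ * ((L : ℝ)⁻¹) ^ K))⁻¹ ≤ g'⁻¹ * g'⁻¹ := by
    rw [hgK, mul_inv]
    exact mul_le_mul_of_nonneg_right (inv_anti₀ hg'pos hle) (inv_nonneg.mpr hg'pos.le)
  calc Real.log (Real.sqrt (γ * ((L : ℝ)⁻¹) ^ K))⁻¹ ≤ Real.log (g'⁻¹ * g'⁻¹) :=
        Real.log_le_log (inv_pos.mpr hgKpos) hinv
    _ = 2 * Real.log g'⁻¹ := by rw [Real.log_mul (inv_ne_zero hg'pos.ne') (inv_ne_zero hg'pos.ne')]; ring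

/-! ## §2 The `p`-function grows by at most `2^{p₀}` when `1 + log g⁻¹` at most doubles -/

/-- **`p(g') ≤ 2^{p₀}·p(g)`** whenever `1 + log g'⁻¹ ≤ 2·(1 + log g⁻¹)`, `0 < g' ≤ 1`, `b₀, p₀ ≥ 0` (then `1 + log g⁻¹ ≥ 0` automatically). [cite: Balaban1985UV3, (7) p.257] -/
theorem pFun_le_two_rpow_mul_pFun (hb : 0 ≤ b₀) (hp : 0 ≤ p₀) {g g' : ℝ} (hg' : 0 < g') (hg'1 : g' ≤ 1)
    (hlog : 1 + Real.log g'⁻¹ ≤ 2 * (1 + Real.log g⁻¹)) : B10.pFun b₀ p₀ g' ≤ (2 : ℝ) ^ p₀ * B10.pFun b₀ p₀ g := by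
  unfold B10.pFun
  have hu' : 0 ≤ 1 + Real.log g'⁻¹ := by linarith [B10.log_inv_nonneg_of_le_one hg' hg'1]
  have hu : 0 ≤ 1 + Real.log g⁻¹ := by linarith
  calc b₀ * (1 + Real.log g'⁻¹) ^ p₀ ≤ b₀ * (2 * (1 + Real.log g⁻¹)) ^ p₀ :=
        mul_le_mul_of_nonneg_left (Real.rpow_le_rpow hu' hlog hp) hb
    _ = (2 : ℝ) ^ p₀ * (b₀ * (1 + Real.log g⁻¹) ^ p₀) := by
        rw [Real.mul_rpow (by norm_num) hu]; ring

/-! ## §3 The threshold ratio -/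

/-- ★★ **THE THRESHOLD RATIO LETTER**: for `0 < γ ≤ 1`, `L ≥ 1`, `b₀ ≥ 0`, `p₀ ≥ 0` and `2j ≤ K`,
`θ(K) ≤ 2^{p₀} · (√L⁻¹)^j · θ(K − j)` — the finest threshold is below the threshold `j` levels up times `L^{−j∕2}`, up to the factor `2^{p₀}` from the
logarithm (`log g_K⁻¹ ≤ 2 log g_{K−j}⁻¹` because `g_{K−j} ≤ L^{−j∕2}` already). [cite: Balaban1985UV3, (3) p.256 and (7) p.257] -/
theorem θBal_le_two_rpow_mul_sqrt_inv_pow_mul (hL : 1 ≤ L) (hγ : 0 < γ) (hγ1 : γ ≤ 1) (hb : 0 ≤ b₀) (hp : 0 ≤ p₀) {K j : ℕ}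
    (hjK : 2 * j ≤ K) : θBal L γ b₀ p₀ K ≤ (2 : ℝ) ^ p₀ * Real.sqrt ((L : ℝ)⁻¹) ^ j * θBal L γ b₀ p₀ (K - j) := by
  have hj : j ≤ K - j := by omega
  have hjK' : j ≤ K := by omega
  rw [θBal_eq, θBal_eq]
  set g' := Real.sqrt (γ * ((L : ℝ)⁻¹) ^ (K - j)) with hg'
  set s := Real.sqrt ((L : ℝ)⁻¹) ^ j with hs
  have hgKpos : 0 < Real.sqrt (γ * ((L : ℝ)⁻¹) ^ K) := (sqrt_coupling_pos_le hL hγ K).1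
  have hgK1 : Real.sqrt (γ * ((L : ℝ)⁻¹) ^ K) ≤ 1 := coupling_le_one hL hγ hγ1 K
  have hgK : Real.sqrt (γ * ((L : ℝ)⁻¹) ^ K) = s * g' := coupling_eq_sqrt_inv_pow_mul L γ hjK'
  have hlog : 1 + Real.log (Real.sqrt (γ * ((L : ℝ)⁻¹) ^ K))⁻¹ ≤ 2 * (1 + Real.log g'⁻¹) := by
    have h := log_inv_coupling_le hL hγ hγ1 (K := K) hj
    linarith
  have hp_le : B10.pFun b₀ p₀ (Real.sqrt (γ * ((L : ℝ)⁻¹) ^ K)) ≤ (2 : ℝ) ^ p₀ * B10.pFun b₀ p₀ g' :=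
    pFun_le_two_rpow_mul_pFun hb hp hgKpos hgK1 hlog
  calc Real.sqrt (γ * ((L : ℝ)⁻¹) ^ K) * B10.pFun b₀ p₀ (Real.sqrt (γ * ((L : ℝ)⁻¹) ^ K))
      ≤ Real.sqrt (γ * ((L : ℝ)⁻¹) ^ K) * ((2 : ℝ) ^ p₀ * B10.pFun b₀ p₀ g') := mul_le_mul_of_nonneg_left hp_le hgKpos.le
    _ = (s * g') * ((2 : ℝ) ^ p₀ * B10.pFun b₀ p₀ g') := by rw [hgK]
    _ = (2 : ℝ) ^ p₀ * s * (g' * B10.pFun b₀ p₀ g') := by ring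

/-- `(√L⁻¹)^j` squared is `(L^j)⁻¹`. [folklore] -/
theorem sqrt_inv_pow_sq (L : ℕ) (j : ℕ) : (Real.sqrt ((L : ℝ)⁻¹) ^ j) ^ 2 = (((L : ℝ) ^ j)⁻¹) := by
  rw [← pow_mul, mul_comm, pow_mul, Real.sq_sqrt (inv_nonneg.mpr (Nat.cast_nonneg L)), inv_pow]

/-- ★ **THE SQUARED FORM**: `θ(K)² ≤ 4^{p₀} · (L^j)⁻¹ · θ(K − j)²` for `2j ≤ K` (`0 < γ ≤ 1`, `L ≥ 1`, `b₀, p₀ ≥ 0`) — the shape in which the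
cap arithmetic compares `β_K·θ_K²` with `L^{−j}·β_K·θ²`. [cite: Balaban1985UV3, (3) p.256 and (7) p.257] -/
theorem θBal_sq_le (hL : 1 ≤ L) (hγ : 0 < γ) (hγ1 : γ ≤ 1) (hb : 0 ≤ b₀) (hp : 0 ≤ p₀) {K j : ℕ} (hjK : 2 * j ≤ K) :
    θBal L γ b₀ p₀ K ^ 2 ≤ (4 : ℝ) ^ p₀ * ((L : ℝ) ^ j)⁻¹ * θBal L γ b₀ p₀ (K - j) ^ 2 := by
  have h := θBal_le_two_rpow_mul_sqrt_inv_pow_mul hL hγ hγ1 hb hp hjK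
  have hθK : 0 ≤ θBal L γ b₀ p₀ K := by
    rw [θBal_eq]
    exact mul_nonneg (Real.sqrt_nonneg _)
      (B10.pFun_nonneg b₀ p₀ _ hb (sqrt_coupling_pos_le hL hγ K).1 (coupling_le_one hL hγ hγ1 K))
  have h2 := pow_le_pow_left₀ hθK h 2
  refine h2.trans (le_of_eq ?_)
  rw [mul_pow, mul_pow, sqrt_inv_pow_sq, ← Real.rpow_natCast ((2 : ℝ) ^ p₀) 2, ← Real.rpow_mul (by norm_num : (0 : ℝ) ≤ 2),
    mul_comm p₀ ((2 : ℕ) : ℝ), Real.rpow_mul (by norm_num : (0 : ℝ) ≤ 2)]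
  norm_num

end Summit.QuantumFields.YangMills.Theorems.CovariantDischargeThresholdRatio

end
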